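import Literature.Computability.Complexity.TruthTableFunctions
import Literature.Computability.Complexity.AdaptiveFunctions
import Literature.Computability.Complexity.PlumbingBricks

/-!
# Truth-table transducers are adaptive transducers with a history-blind query generator

Stub S1 (`stub_ttFn_eq_adFn`) of line `SketchIdeator1` for the crux
`Summit.PneNP.PneNP.Theses.PhaseTwins.NoFBPPApproxAboveUniqueness` (stmt-PneNP-2717).

A non-adaptive truth-table transducer `ttFn Q q G A x = G ⟨x, ttBits Q A x (q |x|)⟩`
(`TruthTableFunctions.lean`; the `i`-th query is `Q ⟨x, 1ⁱ⟩`) is the adaptive transducer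
`adFn Qg q G A x = G ⟨x, adBits Qg A x (q |x|)⟩` (`AdaptiveFunctions.lean`) whose query generator
`Qg := Q ∘ fanoutFn fstF (polyFn X ∘ sndF)` ignores the history except for its length:
`Qg ⟨x, bits⟩ = Q ⟨x, 1^{|bits|}⟩`. The answer bits agree (`ttBits_eq_adBits_blind`, induction on the
number of rounds), hence so do the outputs (`stub_ttFn_eq_adFn`).

## References

* R. E. Ladner, N. A. Lynch, A. L. Selman, *A comparison of polynomial time reducibilities*,
  Theoret. Comput. Sci. 1 (1975) 103–123, §3 (`≤ᵖₜₜ` implies `≤ᵖ_T`) [LadnerLynchSelman1975].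
-/

set_option linter.dupNamespace false

namespace Summit.PneNP.PneNP.Theorems.NoFBPPApproxAboveUniqueness

open Literature.Computability.Complexity _root_.Computability Polynomial Brick Plumb AdQuery

/-- The history-blind generator asks the truth-table queries: on `⟨x, bits⟩` it returns
`Q ⟨x, 1^{|bits|}⟩`. [folklore] -/
theorem blindQ_apply (Q : List Bool → List Bool) (x bits : List Bool) :
    (Q ∘ fanoutFn fstF (polyFn X ∘ sndF)) (boolPair x bits) =
      Q (boolPair x (List.replicate bits.length true)) := by
  rw [Function.comp_apply, fanoutFn_apply, fstF_boolPair, Function.comp_apply, sndF_boolPair,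
    polyFn_apply, eval_X]

/-- **The truth-table answer bits are the adaptive answer bits of the history-blind generator**:
`ttBits Q A x n = adBits (Q ∘ (⟨x, bits⟩ ↦ ⟨x, 1^{|bits|}⟩)) A x n`.
(Ladner–Lynch–Selman 1975, §3: `≤ᵖₜₜ` implies `≤ᵖ_T`.) [cite: LadnerLynchSelman1975, §3] -/
theorem ttBits_eq_adBits_blind (Q : List Bool → List Bool) (A : Language Bool) (x : List Bool) :
    ∀ n, ttBits Q A x n = adBits (Q ∘ fanoutFn fstF (polyFn X ∘ sndF)) A x n
  | 0 => by simp [ttBits]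
  | n + 1 => by
    rw [ttBits_succ, adBits_succ, ← ttBits_eq_adBits_blind Q A x n, blindQ_apply, length_ttBits]

/-- **Stub S1.** `ttFn Q q G A x = adFn (Q ∘ (⟨x, bits⟩ ↦ ⟨x, 1^{|bits|}⟩)) q G A x`: a truth-table
transducer is the adaptive transducer whose query generator reads only the length of the history.
(Ladner–Lynch–Selman 1975, §3: `≤ᵖₜₜ` implies `≤ᵖ_T`.) [cite: LadnerLynchSelman1975, §3] -/
theorem stub_ttFn_eq_adFn (Q : List Bool → List Bool) (q : Polynomial ℕ) (G : List Bool → List Bool)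
    (A : Language Bool) (x : List Bool) :
    ttFn Q q G A x = adFn (Q ∘ fanoutFn fstF (polyFn X ∘ sndF)) q G A x := by
  rw [ttFn_apply, adFn_apply, ttBits_eq_adBits_blind]

end Summit.PneNP.PneNP.Theorems.NoFBPPApproxAboveUniqueness
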